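import Summits.QuantumFields.BalabanUV.T4Continuum.Support.NE7FlatGradientLogCurlPrep
import HarnessLib

/-!
# NE7FlatGradientLetterLogCurl — THE FLAT C¹ COMPACT LETTER, PART (iv): THE LOG-INTERPOLATED CURL DATUM. For a flat (`U = 1`) matrix-valued bond field `Z` supported in a
# cube of radius `R` with `B ≥ sup‖curlAt 1 Z‖`, `B′ ≥` the curl's adjacent differences, `flatDiv Z = g + s` (`‖g‖ ≤ Gb` vanishing off the cube, `s` `D′`-Lipschitz):
# `‖Z(x+e_μ,κ) − Z(x,κ)‖ ≤ C(d)·B·(1 + log⁺((R+1)·B′∕B)) + C(d)·(R+1)·D′ + C′(d)·(1 + log(R+1))·Gb` — the curl part through the Dini∕Calderón–Zygmund shell computation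
# instead of the plain dipole row `(R+1)·B′` (INTERFACE REQUEST NE7→NE7b stub (S-c) (iv), [NE7P1-G107-INBOX-2]; the letter of record for the curl part of AMENDMENT 6's supplier)

Cell `pub-balaban`, rung (B)+1 sub-cell t4; written by the row-NE7b OWNER lineage `b2b-balaban-t4-ne7b-p1` (gen 154) for the sibling crux row NE7 (lineage `t4-ne7-p1`,
gen 107's INTERFACE REQUEST NE7→NE7b stub (S-c) PART (iv), `HOME/INBOX.md` [NE7P1-G107-INBOX-2]: «WHY THE BOOTSTRAP NEEDS (iv) AND NOT ONLY (i): the curl's Lipschitz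
letter of the pair contains the bootstrap quantity — `B′ ∋ 128α·α₁` — and the plain dipole form charges `M·B′`, … the log-interpolated form charges `B_E·(1 + log⁺(MB′∕B_E))` with
`B_E = O(θ^{42k})` and `log⁺(MB′∕B_E) = O(k)` — the rate survives»).  Sequel of parts (i) `NE7FlatGradientLetterCompact`, (iii) `NE7FlatGradientLetterBlockDiv`, and of
`NE7FlatGradientLogCurlPrep` (the shell computation `kernel_sum_bdiff_le`).
WHAT ([folklore]; 0 def, 0 sorry; every `d ≥ 3`; constants existential in `d`).
§1 **`gradient_letter_cube_logCurl_radius`** — the letter with a FREE cut radius `ρ ≥ 2`: `‖Z(x+e_μ)κ − Z x κ‖ ≤ C·[ρ·B′ + (1 + log⁺((2R+3)∕ρ))·B + (R+1)·D′ + (1 + log(R+1))·Gb]`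
   (curl part: `kernel_sum_bdiff_le` for each `ν` on the scalar density `f(curlAt 1 Z (·;ν,κ))`, `f` a real functional; `s`- and `g`-parts as in part (iii); duality).
   The requested closed form (`B·(1 + log⁺((R+1)B′∕B))`, radius chosen from `B∕B′`) is the sequel `NE7FlatGradientLetterLogCurlClosed`.
HONEST FRAMING (page 1): `U = 1`, linear, flat; a JUNCTION over pv23's potential theory; NOT the curved C¹ letter ∕ bootstrap (S-d′), NOT the supplier of socket `h_w`, NOT NE7, nothing of
row NE7b (`T4WeightBudget.RelWeightBound` NOT PRINTED ∕ NOT PROVED); nothing of Bałaban's asserted; spine count = dagwriter∕referees' call; finite T⁴ rung (B)+1 — NOT infinite volume,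
NOT mass gap, NOT BetaPertH, NOT Clay.  Continuum YM on T⁴ ⇐ BetaPertH ∧ nine spine estimates (0/9 proved); BetaPertH ⇐ (D1) ∧ (D4) ∧ CAP+tail; G-an2-4 gates asym, D1 and NE2/3/4.
-/

set_option autoImplicit false

open scoped BigOperators Matrix.Norms.L2Operator
open Finset

namespace Summit.QuantumFields.BalabanUV.T4Continuum.NE7FlatGradientLetterLogCurl

open Literature.MathematicalPhysics.QuantumFieldTheory.Balaban1983to89
open B7Prop1Explicit (Site e)
open T4AveragingDeficitWall (curlAt)
open BlockAveragePushDirSplit (flat)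
open NE3CoercivityScaling (flatDiv)
open Literature.Probability.LatticeModels (latticeLaplacianZd)
open Beta.PoissonInterior (cube mem_cube cube_mono mem_cube_zero_iff supNorm supNorm_le_iff nrm nrm_pos G₀ dG₀ G₀_diff_bound G₀_diff2_bound
  green_rep sum_cube_inv_nrm_pow_le sum_shift)
open NE7FlatGradientLetterCompact (curlAt_flat_diag lap_dual_apply mem_cube_succ_of_add_e)
open NE7FlatGradientModulusPrep (sum_reflect_le)
open NE7FlatGradientLetterBlockDiv (lapVec_eq_curl_g_s sum_cube_inv_nrm_pow_d_le one_add_posLog_le)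
open NE7FlatGradientLogCurlPrep (kernel_sum_bdiff_le curlAt_flat_eq_zero_of_not_mem)

noncomputable section

variable {d : ℕ} {n : Type*} [Fintype n] [DecidableEq n]

/-! ## §1 The letter with a free cut radius -/

/-- **THE FLAT C¹ COMPACT LETTER WITH THE LOG-INTERPOLATED CURL DATUM, FREE RADIUS** (`d ≥ 3`): `∃ C ≥ 0` (a function of `d`) such that for every cube `cube c R`, every bond field
`Z` vanishing off it, every `B` with `‖curlAt 1 Z z μ ν‖ ≤ B` (`μ ≠ ν`), every `B′ ≥ 0` bounding the curl's adjacent differences `‖curlAt 1 Z (z+e_λ) μ ν − curlAt 1 Z z μ ν‖` (`μ ≠ ν`),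
every splitting `flatDiv Z = g + s` with `g` vanishing off `cube c (R+1)`, `‖g‖ ≤ Gb`, `‖s(x+e_λ) − s x‖ ≤ D′`, and every cut radius `ρ ≥ 2`:
`‖Z (x+e_μ) κ − Z x κ‖ ≤ C·(ρ·B′ + (1 + log⁺((2R+3)∕ρ))·B + (R+1)·D′ + (1 + log(R+1))·Gb)`. [folklore] -/
theorem gradient_letter_cube_logCurl_radius (hd : 3 ≤ d) : ∃ C : ℝ, 0 ≤ C ∧
    ∀ (c : Site d) (R : ℕ) (Z : Site d → Fin d → Matrix n n ℂ), (∀ x, x ∉ cube c R → Z x = 0) →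
      ∀ (B : ℝ), (∀ (z : Site d) (μ ν : Fin d), μ ≠ ν → ‖curlAt (flat (d := d) (n := n)) Z z μ ν‖ ≤ B) →
      ∀ (B' : ℝ), 0 ≤ B' → (∀ (z : Site d) (lam μ ν : Fin d), μ ≠ ν →
        ‖curlAt (flat (d := d) (n := n)) Z (z + e lam) μ ν - curlAt (flat (d := d) (n := n)) Z z μ ν‖ ≤ B') →
      ∀ (g s : Site d → Matrix n n ℂ), (∀ x, flatDiv Z x = g x + s x) → (∀ x, x ∉ cube c (R + 1) → g x = 0) →
      ∀ (Gb : ℝ), (∀ x, ‖g x‖ ≤ Gb) → ∀ (D' : ℝ), (∀ (x : Site d) (lam : Fin d), ‖s (x + e lam) - s x‖ ≤ D') →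
      ∀ (ρ : ℕ), 2 ≤ ρ → ∀ (x : Site d) (μ κ : Fin d),
        ‖Z (x + e μ) κ - Z x κ‖ ≤ C * (ρ * B' + (1 + Real.posLog (((2 * R + 3 : ℕ) : ℝ) / ρ)) * B
          + ((R : ℝ) + 1) * D' + (1 + Real.log ((R : ℝ) + 1)) * Gb) := by
  obtain ⟨C₁, hC₁, hG⟩ := G₀_diff_bound hd
  obtain ⟨C₂, hC₂, hG2⟩ := G₀_diff2_bound hd
  have hd0 : 0 < d := by omega
  have hd3 : (3 : ℝ) ≤ d := by exact_mod_cast hd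
  set A : ℝ := 2 * d * 3 ^ (d - 1) with hA
  have hA0 : (0 : ℝ) ≤ A := by positivity
  -- kernel envelopes in the form the shell computation wants
  have hK1 : ∀ (v : Site d) (i : Fin d), |dG₀ i v| ≤ C₁ / nrm v ^ (d - 1) := fun v i => (hG v i).1
  have hK2 : ∀ (v : Site d) (i j : Fin d), |dG₀ i (v + e j) - dG₀ i v| ≤ C₂ / nrm v ^ d := by
    intro v i j
    have h := hG2 v i j
    have : dG₀ i (v + e j) - dG₀ i v = G₀ (v + Pi.single j 1 + Pi.single i 1) - G₀ (v + Pi.single j 1) - G₀ (v + Pi.single i 1) + G₀ v := by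
      show G₀ (v + Pi.single j 1 + Pi.single i 1) - G₀ (v + Pi.single j 1) - (G₀ (v + Pi.single i 1) - G₀ v) = _
      ring
    rw [this]; exact h
  -- one constant for the four terms
  refine ⟨d * C₁ * (1 + A) + d * (2 * A * C₁ + C₂ * 2 ^ d * A) + 4 * C₁ * (1 + A) + 3 * C₂ * (1 + A), by positivity,
    fun c R Z hZ B hBc B' hB0 hB g s hgs hg0 Gb hg D' hs ρ hρ x μ κ => ?_⟩
  have hG00 : 0 ≤ Gb := (norm_nonneg _).trans (hg x)
  have hD0 : 0 ≤ D' := (norm_nonneg _).trans (hs x μ)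
  obtain ⟨ν₀, hν₀⟩ : ∃ ν₀ : Fin d, ν₀ ≠ κ := by
    by_cases h0 : (⟨0, hd0⟩ : Fin d) = κ
    · exact ⟨⟨1, by omega⟩, fun h1 => by have := h0.trans h1.symm; simp [Fin.ext_iff] at this⟩
    · exact ⟨⟨0, hd0⟩, h0⟩
  have hBnn : 0 ≤ B := (norm_nonneg _).trans (hBc x ν₀ κ hν₀)
  have hR0 : (0 : ℝ) ≤ R := by positivity
  have hρ2 : (2 : ℝ) ≤ ρ := by exact_mod_cast hρ
  have hlog0 : 0 ≤ Real.log ((R : ℝ) + 1) := Real.log_nonneg (by linarith)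
  have hP0 : 0 ≤ Real.posLog (((2 * R + 3 : ℕ) : ℝ) / ρ) := Real.posLog_nonneg
  have hrhs0 : 0 ≤ (d * C₁ * (1 + A) + d * (2 * A * C₁ + C₂ * 2 ^ d * A) + 4 * C₁ * (1 + A) + 3 * C₂ * (1 + A))
      * (ρ * B' + (1 + Real.posLog (((2 * R + 3 : ℕ) : ℝ) / ρ)) * B + ((R : ℝ) + 1) * D' + (1 + Real.log ((R : ℝ) + 1)) * Gb) := by
    positivity
  by_cases hx : x ∈ cube c (R + 1)
  swap
  · have h1 : Z x = 0 := hZ x fun h => hx (cube_mono (Nat.le_succ R) h)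
    have h2 : Z (x + e μ) = 0 := hZ (x + e μ) fun h => hx (mem_cube_succ_of_add_e h)
    simp only [h1, h2, Pi.zero_apply, sub_self, norm_zero]
    exact hrhs0
  set T := cube c (R + 2) with hTdef
  have hxT : ∀ y ∈ T, x - y ∈ cube (0 : Site d) (2 * R + 3) := by
    intro y hy
    rw [mem_cube] at hx hy
    rw [mem_cube_zero_iff, supNorm_le_iff]
    intro i
    rw [Beta.PoissonInterior.natAbs_le_iff_abs_le, Pi.sub_apply]
    calc |x i - y i| = |(x i - c i) - (y i - c i)| := by ring_nf
      _ ≤ |x i - c i| + |y i - c i| := abs_sub _ _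
      _ ≤ ((R + 1 : ℕ) : ℤ) + ((R + 2 : ℕ) : ℤ) := add_le_add (hx i) (hy i)
      _ = ((2 * R + 3 : ℕ) : ℤ) := by push_cast; ring
  have hrow1 : ∑ y ∈ T, 1 / nrm (x - y) ^ (d - 1) ≤ 1 + A * ((2 * R + 3 : ℕ) : ℝ) := by
    refine (sum_reflect_le x T _ (fun z => 1 / nrm z ^ (d - 1)) (fun z => one_div_nonneg.mpr (pow_nonneg (nrm_pos z).le _)) hxT).trans ?_
    have h := sum_cube_inv_nrm_pow_le (d := d) hd0 (2 * R + 3) (d - 1) le_rfl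
    rw [Nat.sub_sub_self (by omega : 1 ≤ d), pow_one] at h
    rw [hA]; exact h
  have hrowd : ∑ y ∈ T, 1 / nrm (x - y) ^ d ≤ 1 + A * (1 + Real.posLog ((2 * R + 3 : ℕ) : ℝ)) := by
    have h := (sum_reflect_le x T _ (fun z => 1 / nrm z ^ d) (fun z => one_div_nonneg.mpr (pow_nonneg (nrm_pos z).le _)) hxT).trans
      (sum_cube_inv_nrm_pow_d_le hd0 _)
    rw [hA]; exact h
  have hRow1_0 : (0 : ℝ) ≤ 1 + A * ((2 * R + 3 : ℕ) : ℝ) := by positivity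
  have hPl0 : 0 ≤ Real.posLog ((2 * R + 3 : ℕ) : ℝ) := Real.posLog_nonneg
  have hRowd_0 : (0 : ℝ) ≤ 1 + A * (1 + Real.posLog ((2 * R + 3 : ℕ) : ℝ)) := by positivity
  -- the bound for every real functional
  set Mcurl : ℝ := d * (C₁ * (1 + A * ρ) * B' + 2 * A * C₁ * B + C₂ * 2 ^ d * (A * (1 + Real.posLog (((2 * R + 3 : ℕ) : ℝ) / ρ))) * B) with hMcurl
  set Mtot : ℝ := Mcurl + D' * C₁ * (1 + A * ((2 * R + 3 : ℕ) : ℝ)) + Gb * C₂ * (1 + A * (1 + Real.posLog ((2 * R + 3 : ℕ) : ℝ))) with hMtot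
  have hMcurl0 : 0 ≤ Mcurl := by positivity
  have hM0 : 0 ≤ Mtot := by positivity
  have key : ‖Z (x + e μ) κ - Z x κ‖ ≤ Mtot := by
    refine NormedSpace.norm_le_dual_bound ℝ _ hM0 fun f => ?_
    have hgf : ∀ y, y ∉ cube c (R + 1) → (fun z => f (Z z κ)) y = 0 := fun y hy => by
      simp only [hZ y (fun h => hy (cube_mono (Nat.le_succ R) h)), Pi.zero_apply, map_zero]
    have hrep : f (Z (x + e μ) κ - Z x κ) = -∑ y ∈ T, dG₀ μ (x - y) * latticeLaplacianZd (fun z => f (Z z κ)) y := by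
      have e1 : f (Z (x + e μ) κ) = -∑ y ∈ T, G₀ (x + e μ - y) * latticeLaplacianZd (fun z => f (Z z κ)) y :=
        green_rep hd c (R + 1) (fun z => f (Z z κ)) hgf (x + e μ)
      have e2 : f (Z x κ) = -∑ y ∈ T, G₀ (x - y) * latticeLaplacianZd (fun z => f (Z z κ)) y :=
        green_rep hd c (R + 1) (fun z => f (Z z κ)) hgf x
      rw [map_sub, e1, e2, neg_sub_neg, ← Finset.sum_sub_distrib, ← Finset.sum_neg_distrib]
      refine Finset.sum_congr rfl fun y _ => ?_
      have hy : G₀ (x + e μ - y) = G₀ (x - y + Pi.single μ 1) := by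
        rw [show x + e μ - y = x - y + e μ by abel]
        rfl
      rw [hy, dG₀]
      ring
    -- the scalar densities of the curl
    set φ : Fin d → Site d → ℝ := fun ν y => f (curlAt (flat (d := d) (n := n)) Z y ν κ) with hφ
    have hφ0 : ∀ ν y, y ∉ cube c (R + 1) → φ ν y = 0 := fun ν y hy => by
      simp only [hφ, curlAt_flat_eq_zero_of_not_mem hZ hy, map_zero]
    have hφb : ∀ ν y, |φ ν y| ≤ ‖f‖ * B := by
      intro ν y
      by_cases hν : ν = κ
      · subst hν; simp only [hφ, curlAt_flat_diag, map_zero, abs_zero]; positivity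
      · rw [← Real.norm_eq_abs]; exact (f.le_opNorm _).trans (mul_le_mul_of_nonneg_left (hBc y ν κ hν) (norm_nonneg _))
    have hφb' : ∀ ν y (lam : Fin d), |φ ν (y + e lam) - φ ν y| ≤ ‖f‖ * B' := by
      intro ν y lam
      by_cases hν : ν = κ
      · subst hν; simp only [hφ, curlAt_flat_diag, map_zero, sub_zero, abs_zero]; positivity
      · rw [← Real.norm_eq_abs, hφ]
        dsimp only
        rw [← map_sub]
        exact (f.le_opNorm _).trans (mul_le_mul_of_nonneg_left (hB y lam ν κ hν) (norm_nonneg _))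
    -- split the scalar Laplacian
    have hlap : ∀ y, latticeLaplacianZd (fun z => f (Z z κ)) y
        = (∑ ν, (φ ν y - φ ν (y - e ν))) + f (s (y + e κ) - s y) + (f (g (y + e κ)) - f (g y)) := by
      intro y
      rw [lap_dual_apply, lapVec_eq_curl_g_s Z g s hgs]
      simp only [map_add, map_sub, map_sum, hφ]
      ring
    -- the curl part, direction by direction
    have hcurlν : ∀ ν, |∑ y ∈ T, dG₀ μ (x - y) * (φ ν y - φ ν (y - e ν))|
        ≤ C₁ * (1 + A * ρ) * (‖f‖ * B') + 2 * A * C₁ * (‖f‖ * B) + C₂ * 2 ^ d * (A * (1 + Real.posLog (((2 * R + 3 : ℕ) : ℝ) / ρ))) * (‖f‖ * B) := by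
      intro ν
      have h := kernel_sum_bdiff_le (d := d) hd hC₁ hC₂ hK1 hK2 c x R hx (φ ν) (hφ0 ν) (hφb ν) (hφb' ν) μ ν ρ hρ
      rw [hA]; exact h
    have hcurl : ‖∑ y ∈ T, dG₀ μ (x - y) * ∑ ν, (φ ν y - φ ν (y - e ν))‖ ≤ Mcurl * ‖f‖ := by
      rw [Real.norm_eq_abs]
      have hswap : ∑ y ∈ T, dG₀ μ (x - y) * ∑ ν, (φ ν y - φ ν (y - e ν)) = ∑ ν, ∑ y ∈ T, dG₀ μ (x - y) * (φ ν y - φ ν (y - e ν)) := by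
        rw [Finset.sum_comm]; exact Finset.sum_congr rfl fun y _ => Finset.mul_sum _ _ _
      rw [hswap]
      calc |∑ ν, ∑ y ∈ T, dG₀ μ (x - y) * (φ ν y - φ ν (y - e ν))|
          ≤ ∑ ν : Fin d, (C₁ * (1 + A * ρ) * (‖f‖ * B') + 2 * A * C₁ * (‖f‖ * B) + C₂ * 2 ^ d * (A * (1 + Real.posLog (((2 * R + 3 : ℕ) : ℝ) / ρ))) * (‖f‖ * B)) :=
            (Finset.abs_sum_le_sum_abs _ _).trans (Finset.sum_le_sum fun ν _ => hcurlν ν)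
        _ = Mcurl * ‖f‖ := by rw [Finset.sum_const, Finset.card_univ, Fintype.card_fin, nsmul_eq_mul, hMcurl]; ring
    -- the `s` part
    have hspart : ‖∑ y ∈ T, dG₀ μ (x - y) * f (s (y + e κ) - s y)‖ ≤ D' * C₁ * (1 + A * ((2 * R + 3 : ℕ) : ℝ)) * ‖f‖ := by
      calc _ ≤ ∑ y ∈ T, (C₁ * (1 / nrm (x - y) ^ (d - 1))) * (‖f‖ * D') :=
            (norm_sum_le _ _).trans (Finset.sum_le_sum fun y _ => by
              rw [norm_mul, Real.norm_eq_abs]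
              exact mul_le_mul (((hK1 _ μ)).trans (le_of_eq (by ring)))
                ((f.le_opNorm _).trans (mul_le_mul_of_nonneg_left (hs y κ) (norm_nonneg _))) (norm_nonneg _)
                (mul_nonneg hC₁ (one_div_nonneg.mpr (pow_nonneg (nrm_pos _).le _))))
        _ = C₁ * (‖f‖ * D') * ∑ y ∈ T, 1 / nrm (x - y) ^ (d - 1) := by
            rw [Finset.mul_sum]; exact Finset.sum_congr rfl fun y _ => by ring
        _ ≤ C₁ * (‖f‖ * D') * (1 + A * ((2 * R + 3 : ℕ) : ℝ)) := mul_le_mul_of_nonneg_left hrow1 (by positivity)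
        _ = _ := by ring
    -- the `g` part, summed by parts
    have hshift : ∑ y ∈ T, dG₀ μ (x - y) * f (g (y + e κ)) = ∑ y ∈ T, dG₀ μ (x - y + e κ) * f (g y) := by
      have h := sum_shift T (e κ) (fun y => dG₀ μ (x - y + e κ) * f (g y))
        (fun y hy => by
          have : g y = 0 := hg0 y fun h => hy (cube_mono (by omega) h)
          simp only [this, map_zero, mul_zero])
        (fun y hy => by
          have hgy : g y ≠ 0 := by
            intro h0; apply hy; simp only [h0, map_zero, mul_zero]
          have hyc : y ∈ cube c (R + 1) := by by_contra h'; exact hgy (hg0 y h')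
          rw [mem_cube] at hyc ⊢
          intro i
          have h1 := hyc i
          have hs1 : |(e κ : Site d) i| ≤ 1 := by
            change |(Pi.single κ (1 : ℤ) : Site d) i| ≤ 1
            rw [Pi.single_apply]; split_ifs <;> simp
          rw [Pi.sub_apply]
          calc |y i - (e κ : Site d) i - c i| = |(y i - c i) - (e κ : Site d) i| := by ring_nf
            _ ≤ |y i - c i| + |(e κ : Site d) i| := abs_sub _ _
            _ ≤ ((R + 1 : ℕ) : ℤ) + 1 := add_le_add h1 hs1
            _ = ((R + 2 : ℕ) : ℤ) := by push_cast; ring)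
      rw [← h]
      refine Finset.sum_congr rfl fun y _ => ?_
      rw [show x - (y + e κ) + e κ = x - y by abel]
    have hgsum : ∑ y ∈ T, dG₀ μ (x - y) * (f (g (y + e κ)) - f (g y))
        = ∑ y ∈ T, (dG₀ μ (x - y + e κ) - dG₀ μ (x - y)) * f (g y) := by
      simp only [mul_sub, Finset.sum_sub_distrib, hshift, sub_mul]
    have hgpart : ‖∑ y ∈ T, (dG₀ μ (x - y + e κ) - dG₀ μ (x - y)) * f (g y)‖
        ≤ Gb * C₂ * (1 + A * (1 + Real.posLog ((2 * R + 3 : ℕ) : ℝ))) * ‖f‖ := by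
      calc _ ≤ ∑ y ∈ T, (C₂ * (1 / nrm (x - y) ^ d)) * (‖f‖ * Gb) :=
            (norm_sum_le _ _).trans (Finset.sum_le_sum fun y _ => by
              rw [norm_mul, Real.norm_eq_abs]
              refine mul_le_mul ((hK2 _ μ κ).trans (le_of_eq (by ring))) ?_ (norm_nonneg _)
                (mul_nonneg hC₂ (one_div_nonneg.mpr (pow_nonneg (nrm_pos _).le _)))
              exact (f.le_opNorm _).trans (mul_le_mul_of_nonneg_left (hg y) (norm_nonneg _)))
        _ = C₂ * (‖f‖ * Gb) * ∑ y ∈ T, 1 / nrm (x - y) ^ d := by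
            rw [Finset.mul_sum]; exact Finset.sum_congr rfl fun y _ => by ring
        _ ≤ C₂ * (‖f‖ * Gb) * (1 + A * (1 + Real.posLog ((2 * R + 3 : ℕ) : ℝ))) := mul_le_mul_of_nonneg_left hrowd (by positivity)
        _ = _ := by ring
    -- assemble
    rw [hrep, norm_neg]
    have hsplit : ∑ y ∈ T, dG₀ μ (x - y) * latticeLaplacianZd (fun z => f (Z z κ)) y
        = ∑ y ∈ T, dG₀ μ (x - y) * ∑ ν, (φ ν y - φ ν (y - e ν))
          + ∑ y ∈ T, dG₀ μ (x - y) * f (s (y + e κ) - s y)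
          + ∑ y ∈ T, (dG₀ μ (x - y + e κ) - dG₀ μ (x - y)) * f (g y) := by
      rw [← hgsum, ← Finset.sum_add_distrib, ← Finset.sum_add_distrib]
      exact Finset.sum_congr rfl fun y _ => by rw [hlap]; ring
    rw [hsplit]
    calc _ ≤ ‖∑ y ∈ T, dG₀ μ (x - y) * ∑ ν, (φ ν y - φ ν (y - e ν)) + ∑ y ∈ T, dG₀ μ (x - y) * f (s (y + e κ) - s y)‖
          + ‖∑ y ∈ T, (dG₀ μ (x - y + e κ) - dG₀ μ (x - y)) * f (g y)‖ := norm_add_le _ _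
      _ ≤ (Mcurl * ‖f‖ + D' * C₁ * (1 + A * ((2 * R + 3 : ℕ) : ℝ)) * ‖f‖) + Gb * C₂ * (1 + A * (1 + Real.posLog ((2 * R + 3 : ℕ) : ℝ))) * ‖f‖ :=
          add_le_add ((norm_add_le _ _).trans (add_le_add hcurl hspart)) hgpart
      _ = Mtot * ‖f‖ := by rw [hMtot]; ring
  -- relax the constants: `1 + Aρ ≤ (1 + A)ρ`, row sums as in part (iii)
  have hρ1 : (1 : ℝ) ≤ ρ := by linarith
  set P : ℝ := Real.posLog (((2 * R + 3 : ℕ) : ℝ) / ρ) with hP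
  have hP0' : 0 ≤ P := Real.posLog_nonneg
  have h1 : C₁ * (1 + A * ρ) ≤ C₁ * (1 + A) * ρ := by
    have h0 : 1 + A * ρ ≤ (1 + A) * ρ := by
      have : A * ρ ≤ A * ρ := le_rfl
      nlinarith only [hA0, hρ1]
    have e1 : C₁ * (1 + A) * ρ = C₁ * ((1 + A) * ρ) := by ring
    rw [e1]
    exact mul_le_mul_of_nonneg_left h0 hC₁
  have hRow1' : 1 + A * ((2 * R + 3 : ℕ) : ℝ) ≤ (1 + A) * (4 * ((R : ℝ) + 1)) := by
    have hc : ((2 * R + 3 : ℕ) : ℝ) = 2 * R + 3 := by push_cast; ring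
    rw [hc]
    have h2 : A * (2 * (R : ℝ) + 3) ≤ A * (4 * ((R : ℝ) + 1)) := mul_le_mul_of_nonneg_left (by linarith) hA0
    linarith only [h2, hA0, hR0]
  have hRowd' : 1 + A * (1 + Real.posLog ((2 * R + 3 : ℕ) : ℝ)) ≤ (1 + A) * (3 * (1 + Real.log ((R : ℝ) + 1))) := by
    have h3 := one_add_posLog_le R
    have h4 : A * (1 + Real.posLog ((2 * R + 3 : ℕ) : ℝ)) ≤ A * (3 * (1 + Real.log ((R : ℝ) + 1))) := mul_le_mul_of_nonneg_left h3 hA0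
    linarith only [h4, hlog0]
  -- the four data, all nonnegative
  have hX1 : 0 ≤ (ρ : ℝ) * B' := by positivity
  have hX2 : 0 ≤ (1 + P) * B := by positivity
  have hX3 : 0 ≤ ((R : ℝ) + 1) * D' := by positivity
  have hX4 : 0 ≤ (1 + Real.log ((R : ℝ) + 1)) * Gb := by positivity
  -- the four coefficients, each below the total constant
  set a₁ : ℝ := d * C₁ * (1 + A) with ha₁
  set a₂ : ℝ := d * (2 * A * C₁ + C₂ * 2 ^ d * A) with ha₂
  set a₃ : ℝ := 4 * C₁ * (1 + A) with ha₃
  set a₄ : ℝ := 3 * C₂ * (1 + A) with ha₄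
  have ha₁0 : 0 ≤ a₁ := by positivity
  have ha₂0 : 0 ≤ a₂ := by positivity
  have ha₃0 : 0 ≤ a₃ := by positivity
  have ha₄0 : 0 ≤ a₄ := by positivity
  have step1 : Mtot ≤ a₁ * (ρ * B') + a₂ * ((1 + P) * B) + a₃ * (((R : ℝ) + 1) * D') + a₄ * ((1 + Real.log ((R : ℝ) + 1)) * Gb) := by
    have e0 : Mtot = d * (C₁ * (1 + A * ρ) * B' + 2 * A * C₁ * B + C₂ * 2 ^ d * (A * (1 + P)) * B)
        + D' * C₁ * (1 + A * ((2 * R + 3 : ℕ) : ℝ)) + Gb * C₂ * (1 + A * (1 + Real.posLog ((2 * R + 3 : ℕ) : ℝ))) := by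
      rw [hMtot, hMcurl]
    rw [e0]
    have hd0' : (0 : ℝ) ≤ d := by positivity
    have t1 : C₁ * (1 + A * ρ) * B' ≤ C₁ * (1 + A) * ρ * B' := mul_le_mul_of_nonneg_right h1 hB0
    have t2 : 2 * A * C₁ * B ≤ 2 * A * C₁ * ((1 + P) * B) := by
      linarith only [mul_nonneg (mul_nonneg (mul_nonneg hA0 hC₁) hBnn) hP0']
    have t3 : D' * C₁ * (1 + A * ((2 * R + 3 : ℕ) : ℝ)) ≤ D' * C₁ * ((1 + A) * (4 * ((R : ℝ) + 1))) :=
      mul_le_mul_of_nonneg_left hRow1' (by positivity)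
    have t4 : Gb * C₂ * (1 + A * (1 + Real.posLog ((2 * R + 3 : ℕ) : ℝ))) ≤ Gb * C₂ * ((1 + A) * (3 * (1 + Real.log ((R : ℝ) + 1)))) :=
      mul_le_mul_of_nonneg_left hRowd' (by positivity)
    have tcurl : d * (C₁ * (1 + A * ρ) * B' + 2 * A * C₁ * B + C₂ * 2 ^ d * (A * (1 + P)) * B)
        ≤ d * (C₁ * (1 + A) * ρ * B' + 2 * A * C₁ * ((1 + P) * B) + C₂ * 2 ^ d * (A * (1 + P)) * B) :=
      mul_le_mul_of_nonneg_left (by linarith only [t1, t2]) hd0'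
    calc _ ≤ d * (C₁ * (1 + A) * ρ * B' + 2 * A * C₁ * ((1 + P) * B) + C₂ * 2 ^ d * (A * (1 + P)) * B)
          + D' * C₁ * ((1 + A) * (4 * ((R : ℝ) + 1))) + Gb * C₂ * ((1 + A) * (3 * (1 + Real.log ((R : ℝ) + 1)))) :=
          add_le_add (add_le_add tcurl t3) t4
      _ = a₁ * (ρ * B') + a₂ * ((1 + P) * B) + a₃ * (((R : ℝ) + 1) * D') + a₄ * ((1 + Real.log ((R : ℝ) + 1)) * Gb) := by
          rw [ha₁, ha₂, ha₃, ha₄]; ring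
  have step2 : a₁ * (ρ * B') + a₂ * ((1 + P) * B) + a₃ * (((R : ℝ) + 1) * D') + a₄ * ((1 + Real.log ((R : ℝ) + 1)) * Gb)
      ≤ (a₁ + a₂ + a₃ + a₄) * (ρ * B' + (1 + P) * B + ((R : ℝ) + 1) * D' + (1 + Real.log ((R : ℝ) + 1)) * Gb) := by
    linarith only [mul_nonneg ha₁0 hX2, mul_nonneg ha₁0 hX3, mul_nonneg ha₁0 hX4, mul_nonneg ha₂0 hX1, mul_nonneg ha₂0 hX3, mul_nonneg ha₂0 hX4,
      mul_nonneg ha₃0 hX1, mul_nonneg ha₃0 hX2, mul_nonneg ha₃0 hX4, mul_nonneg ha₄0 hX1, mul_nonneg ha₄0 hX2, mul_nonneg ha₄0 hX3]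
  have hC : a₁ + a₂ + a₃ + a₄ = d * C₁ * (1 + A) + d * (2 * A * C₁ + C₂ * 2 ^ d * A) + 4 * C₁ * (1 + A) + 3 * C₂ * (1 + A) := by
    rw [ha₁, ha₂, ha₃, ha₄]
  calc ‖Z (x + e μ) κ - Z x κ‖ ≤ Mtot := key
    _ ≤ _ := step1
    _ ≤ _ := step2
    _ = _ := by rw [hC]


end

end Summit.QuantumFields.BalabanUV.T4Continuum.NE7FlatGradientLetterLogCurl
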